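import Literature.Geometry.Lorentzian.ConicBogovskiiDelta
import Mathlib.Analysis.Convex.Star
import HarnessLib

/-!
# The Bogovskiĭ-type kernel of Mao–Oh–Tao's Lemma 2.3: `div (w z/|z|³) = δ₀ − η(· + y)`

(trunk G08 = T-LORENTZ; family `gr`; namespace `Literature.Geometry.Lorentzian.MaoOhTao`.)

Mao–Oh–Tao (arXiv:2308.13031), Lemma 2.3 inverts the double divergence `h ↦ ∂_i∂_j h^{ij}` on an open set `Ω` that
is star-shaped with respect to a ball `B`, with support in `Ω`, by the Bogovskiĭ-type kernel

  `Ψ^{ij}_η(z + y, y) = w_y(z) zⁱzʲ/|z|³`,  `w_y(z) = ∫_{|z|}^∞ η(r z/|z| + y) r² dr`,  `η ∈ C^∞_c(B)`, `∫ η = 1`,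

and the proof of (S2) rests on the classical Bogovskiĭ identity (Bogovskiĭ 1979; the paper, p. 9)

  `∂_{zⁱ} [ (zⁱ/|z|³) ∫_{|z|}^∞ η(r z/|z| + y) r² dr ] = δ₀(z) − η(z + y)`.

This file defines the radial weight `bogovskiiWeight η y r α = ∫_{(r, ∞)} η(s α + y) s² ds` and proves:

* its regularity (`hasDerivAt_bogovskiiWeight`: `∂_r w = −η(rα + y) r²`; joint continuity; vanishing for large `r`;
  `integral_bogovskiiWeight_zero`: `∫_{S²} w(0, α) dσ(α) = ∫ η`, polar coordinates);
* the Bogovskiĭ identity in weak form (`integral_bogovskiiWeight_fderiv_apply_self_eq`): for `φ ∈ C¹_c(ℝ³)`,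
  `∫ w_y(z) |z|⁻³ Dφ(z)·z dz = −φ(0) ∫ η + ∫ η(z + y) φ(z) dz`;
* (S1) (`add_mem_of_bogovskiiWeight_ne_zero`): if `Ω` is star-shaped with respect to every point of `B ⊇ supp η` and
  `y ∈ Ω`, then `w_y(z) ≠ 0` forces `z + y ∈ Ω`.

The radial technique is that of `ConicBogovskiiDelta.lean`, with sphere weights depending on the radius
(`hasDerivAt_integral_rweight_mul`).  Everything is proved; the only definition is the weight `bogovskiiWeight`; no
named facts.  Not treated here: the second-order formula `∂_i∂_j Ψ_η(z + y, y) = δ₀(z) − 4η(z + y) − zⁱ(∂ᵢη)(z + y)`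
(p. 9) and the operator-level (S2) under the moment conditions `∫ f = ∫ x_j f = 0`, the vector kernel `(Ψ_η)^{ij}_k`,
and the pseudo-differential bounds (S3), (S4).

## References

* Y. Mao, S.-J. Oh, T. Tao, *Initial data gluing in the asymptotically flat regime via solution operators with
  prescribed support properties*, arXiv:2308.13031 (2023), Lemma 2.3 and its proof (key `MaoOhTao2023`).
* M. E. Bogovskiĭ, *Solution of the first boundary value problem for an equation of continuity of an incompressible
  medium*, Dokl. Akad. Nauk SSSR 248 (1979), 1037–1040.
-/

noncomputable section

open scoped RealInnerProductSpace Topology ContDiff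
open Filter MeasureTheory Set Metric Function
open Literature.Analysis.FluidPDE

namespace Literature.Geometry.Lorentzian

namespace MaoOhTao

/-! ### Integrability of `b(z) |z|⁻³ q(z)` for a bounded weight -/

section Integrability

/-- `|zᵢ| ≤ |z|` (a private copy of a FluidPDE helper). [folklore] -/
private theorem abs_apply_le_norm (v : E3) (i : Fin 3) : |v i| ≤ ‖v‖ := by
  simpa using PiLp.norm_apply_le v i

/-- **Integrability against a bounded singular weight.** For `b` continuous and bounded off the origin and a continuous,
compactly supported `q` with `|q(z)| ≤ C |z|`, the function `b(z) |z|⁻³ q(z)` is integrable on `ℝ³` (`O(|z|⁻²)` at the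
origin; the non-homogeneous form of `integrable_kernel_mul_of_le`). [folklore] -/
theorem integrable_weight_mul_of_le {b : E3 → ℝ} (hb : ContinuousOn b {0}ᶜ) {W : ℝ}
    (hbW : ∀ z : E3, z ≠ 0 → |b z| ≤ W) {q : E3 → ℝ} (hq : Continuous q) (hqc : HasCompactSupport q)
    {C : ℝ} (hqb : ∀ z, |q z| ≤ C * ‖z‖) :
    Integrable fun z : E3 ↦ b z * ((‖z‖ ^ 3)⁻¹ * q z) := by
  obtain ⟨R, hR⟩ := hqc.isCompact.isBounded.subset_closedBall 0
  set F : E3 → ℝ := fun z ↦ b z * ((‖z‖ ^ 3)⁻¹ * q z) with hFdef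
  have hsupp : support F ⊆ ball (0 : E3) (R + 1) := by
    intro z hz
    rw [mem_ball_zero_iff]
    by_contra h
    have hz' : R < ‖z‖ := by linarith [not_lt.1 h]
    have hq0 : q z = 0 := eq_zero_of_lt_norm hR hz'
    exact hz (by simp [hFdef, hq0])
  rw [← integrableOn_iff_integrable_of_support_subset hsupp]
  have hcont : ContinuousOn F {0}ᶜ := by
    refine hb.mul ((ContinuousOn.inv₀ ((continuous_norm.pow 3).continuousOn) fun z hz ↦ ?_).mul
      hq.continuousOn)
    exact pow_ne_zero 3 (norm_ne_zero_iff.2 (mem_compl_singleton_iff.1 hz))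
  have hmeas : AEStronglyMeasurable F (volume : Measure E3) := by
    have h := hcont.aestronglyMeasurable (μ := (volume : Measure E3))
      (measurableSet_singleton (0 : E3)).compl
    rwa [restrict_compl_singleton] at h
  refine integrableOn_ball_of_norm_le_rpow (by rw [finrank_euclideanSpace_fin]; norm_num)
    (C := max W 0 * max C 0) (α := 2) (by rw [finrank_euclideanSpace_fin]; norm_num)
    (Eventually.of_forall fun z ↦ ?_) hmeas
  by_cases hz : z = 0
  · subst hz
    have h0 : F 0 = 0 := by simp [hFdef]
    simp only [h0, norm_zero, Real.zero_rpow (show (-(2 : ℝ)) ≠ 0 by norm_num), mul_zero, le_refl]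
  · have hn : 0 < ‖z‖ := norm_pos_iff.2 hz
    have hrpow : ‖z‖ ^ (-(2 : ℝ)) = (‖z‖ ^ 2)⁻¹ := by
      rw [Real.rpow_neg hn.le, Real.rpow_two]
    rw [Real.norm_eq_abs, hrpow, hFdef]
    simp only [abs_mul, abs_inv, abs_pow, abs_norm]
    have hqz : |q z| ≤ max C 0 * ‖z‖ :=
      (hqb z).trans (mul_le_mul_of_nonneg_right (le_max_left _ _) hn.le)
    have hbz : |b z| ≤ max W 0 := (hbW z hz).trans (le_max_left _ _)
    calc |b z| * ((‖z‖ ^ 3)⁻¹ * |q z|) ≤ max W 0 * ((‖z‖ ^ 3)⁻¹ * (max C 0 * ‖z‖)) :=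
          mul_le_mul hbz (mul_le_mul_of_nonneg_left hqz (by positivity)) (by positivity) (le_max_right _ _)
      _ = max W 0 * max C 0 * (‖z‖ ^ 2)⁻¹ := by
          field_simp

end Integrability

/-! ### Sphere integrals with radius-dependent weights -/

section RWeight

variable {w w' : ℝ → sphere (0 : E3) 1 → ℝ} {φ : E3 → ℝ}

/-- **Differentiating `∫ w(r, α) φ(rα) dσ(α)` in the radius** for a weight `w` jointly continuous on `ℝ × 𝕊²`,
differentiable in `r` with jointly continuous derivative `w'`, and `φ ∈ C¹(ℝ³)`:
`d/dr ∫ w(r,α) φ(rα) dσ = ∫ (w'(r,α) φ(rα) + w(r,α) Dφ(rα)·α) dσ` (differentiation under the integral sign, dominated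
on `[r−1, r+1] × 𝕊²` by the maximum of the continuous derivative). [folklore] -/
theorem hasDerivAt_integral_rweight_mul (hw : Continuous (uncurry w)) (hw' : Continuous (uncurry w'))
    (hwd : ∀ r α, HasDerivAt (fun ρ ↦ w ρ α) (w' r α) r) (hφ : ContDiff ℝ 1 φ) (r : ℝ) :
    HasDerivAt (fun ρ : ℝ ↦ ∫ α, w ρ α * φ (ρ • (α : E3)) ∂(volume : Measure E3).toSphere)
      (∫ α, (w' r α * φ (r • (α : E3)) + w r α * fderiv ℝ φ (r • (α : E3)) (α : E3))
        ∂(volume : Measure E3).toSphere) r := by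
  have hfd : Differentiable ℝ φ := hφ.differentiable one_ne_zero
  have hfc : Continuous (fderiv ℝ φ) := hφ.continuous_fderiv one_ne_zero
  -- the integrand and its `r`-derivative, jointly continuous
  have hF : Continuous (uncurry fun (ρ : ℝ) (α : sphere (0 : E3) 1) ↦ w ρ α * φ (ρ • (α : E3))) :=
    hw.mul (hφ.continuous.comp (continuous_fst.smul (continuous_subtype_val.comp continuous_snd)))
  have hF' : Continuous (uncurry fun (ρ : ℝ) (α : sphere (0 : E3) 1) ↦
      w' ρ α * φ (ρ • (α : E3)) + w ρ α * fderiv ℝ φ (ρ • (α : E3)) (α : E3)) :=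
    (hw'.mul (hφ.continuous.comp (continuous_fst.smul (continuous_subtype_val.comp continuous_snd)))).add
      (hw.mul (((hfc.comp (continuous_fst.smul (continuous_subtype_val.comp continuous_snd))).clm_apply
        (continuous_subtype_val.comp continuous_snd))))
  -- a uniform bound for the derivative on `[r-1, r+1] × 𝕊²`
  obtain ⟨C, hC⟩ := (isCompact_Icc.prod isCompact_univ :
      IsCompact (Icc (r - 1) (r + 1) ×ˢ (univ : Set (sphere (0 : E3) 1)))).exists_bound_of_continuousOn
    hF'.continuousOn
  have hs : Ioo (r - 1) (r + 1) ∈ 𝓝 r := Ioo_mem_nhds (by linarith) (by linarith)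
  have hslice : ∀ ρ : ℝ, Continuous fun α : sphere (0 : E3) 1 ↦ w ρ α * φ (ρ • (α : E3)) := fun ρ ↦
    hF.comp (Continuous.prodMk_right ρ)
  have hslice' : ∀ ρ : ℝ, Continuous fun α : sphere (0 : E3) 1 ↦
      w' ρ α * φ (ρ • (α : E3)) + w ρ α * fderiv ℝ φ (ρ • (α : E3)) (α : E3) := fun ρ ↦
    hF'.comp (Continuous.prodMk_right ρ)
  have hint : ∀ ρ : ℝ, Integrable (fun α : sphere (0 : E3) 1 ↦ w ρ α * φ (ρ • (α : E3)))
      (volume : Measure E3).toSphere := fun ρ ↦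
    integrableOn_univ.1 ((hslice ρ).continuousOn.integrableOn_compact isCompact_univ)
  refine (hasDerivAt_integral_of_dominated_loc_of_deriv_le (μ := (volume : Measure E3).toSphere)
    (F := fun (ρ : ℝ) (α : sphere (0 : E3) 1) ↦ w ρ α * φ (ρ • (α : E3)))
    (F' := fun (ρ : ℝ) (α : sphere (0 : E3) 1) ↦
      w' ρ α * φ (ρ • (α : E3)) + w ρ α * fderiv ℝ φ (ρ • (α : E3)) (α : E3))
    (bound := fun _ ↦ C) hs
    (Eventually.of_forall fun ρ ↦ (hslice ρ).aestronglyMeasurable) (hint r)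
    (hslice' r).aestronglyMeasurable ?_ (integrable_const _) ?_).2
  · refine ae_of_all _ fun α ρ hρ ↦ ?_
    exact hC (ρ, α) ⟨⟨hρ.1.le, hρ.2.le⟩, mem_univ _⟩
  · refine ae_of_all _ fun α ρ _ ↦ ?_
    have h1 : HasDerivAt (fun ρ : ℝ ↦ ρ • (α : E3)) ((1 : ℝ) • (α : E3)) ρ :=
      (hasDerivAt_id ρ).smul_const (α : E3)
    rw [one_smul] at h1
    exact (hwd ρ α).mul ((hfd (ρ • (α : E3))).hasFDerivAt.comp_hasDerivAt ρ h1)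

/-- The derivative `r ↦ ∫ (w' φ(rα) + w Dφ(rα)·α) dσ` is continuous in the radius. [folklore] -/
theorem continuous_integral_rweight_deriv (hw : Continuous (uncurry w)) (hw' : Continuous (uncurry w'))
    (hφ : ContDiff ℝ 1 φ) :
    Continuous fun ρ : ℝ ↦ ∫ α, (w' ρ α * φ (ρ • (α : E3)) + w ρ α * fderiv ℝ φ (ρ • (α : E3)) (α : E3))
      ∂(volume : Measure E3).toSphere := by
  have hF' : Continuous (uncurry fun (ρ : ℝ) (α : sphere (0 : E3) 1) ↦
      w' ρ α * φ (ρ • (α : E3)) + w ρ α * fderiv ℝ φ (ρ • (α : E3)) (α : E3)) :=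
    (hw'.mul (hφ.continuous.comp (continuous_fst.smul (continuous_subtype_val.comp continuous_snd)))).add
      (hw.mul ((((hφ.continuous_fderiv one_ne_zero).comp
        (continuous_fst.smul (continuous_subtype_val.comp continuous_snd))).clm_apply
        (continuous_subtype_val.comp continuous_snd))))
  have h := continuous_parametric_integral_of_continuous (μ := (volume : Measure E3).toSphere) hF'
    isCompact_univ
  simp only [Measure.restrict_univ] at h
  exact h

/-- A jointly continuous integrand has sphere integrals continuous in the radius. [folklore] -/
theorem continuous_integral_rweight (hw : Continuous (uncurry w)) {g : E3 → ℝ} (hg : Continuous g) :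
    Continuous fun ρ : ℝ ↦ ∫ α, w ρ α * g (ρ • (α : E3)) ∂(volume : Measure E3).toSphere := by
  have hF : Continuous (uncurry fun (ρ : ℝ) (α : sphere (0 : E3) 1) ↦ w ρ α * g (ρ • (α : E3))) :=
    hw.mul (hg.comp (continuous_fst.smul (continuous_subtype_val.comp continuous_snd)))
  have h := continuous_parametric_integral_of_continuous (μ := (volume : Measure E3).toSphere) hF
    isCompact_univ
  simp only [Measure.restrict_univ] at h
  exact h

end RWeight

/-! ### The Bogovskiĭ weight `w_y(r, α) = ∫_r^∞ η(sα + y) s² ds` -/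

section Weight

/-- **The radial weight of the Bogovskiĭ-type kernel** of Mao–Oh–Tao's Lemma 2.3:
`w_y(r, α) = ∫_{(r, ∞)} η(s α + y) s² ds`, so that `Ψ^{ij}_η(z + y, y) = w_y(|z|, z/|z|) zⁱzʲ/|z|³`.
[cite: MaoOhTao2023, Lemma 2.3] -/
def bogovskiiWeight (η : E3 → ℝ) (y : E3) (r : ℝ) (α : E3) : ℝ :=
  ∫ s in Ioi r, η (s • α + y) * s ^ 2

variable {η : E3 → ℝ} {y : E3} {R : ℝ}

/-- Off the support: if `η` vanishes outside `B̄_R(0)` and `|α| = 1`, then `η(sα + y) = 0` for `|s| > R + |y|`.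
[folklore] -/
theorem eta_line_eq_zero (hR : ∀ z : E3, R < ‖z‖ → η z = 0) {α : E3} (hα : ‖α‖ = 1) {s : ℝ}
    (hs : R + ‖y‖ < |s|) : η (s • α + y) = 0 := by
  apply hR
  have h1 : ‖s • α‖ = |s| := by rw [norm_smul, hα, mul_one, Real.norm_eq_abs]
  have h2 : ‖s • α‖ ≤ ‖s • α + y‖ + ‖y‖ := by
    calc ‖s • α‖ = ‖(s • α + y) - y‖ := by rw [add_sub_cancel_right]
      _ ≤ ‖s • α + y‖ + ‖y‖ := norm_sub_le _ _
  linarith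

/-- The line integrand `s ↦ η(sα + y) s²` is continuous for continuous `η`. [folklore] -/
theorem continuous_eta_line (hη : Continuous η) (α y : E3) :
    Continuous fun s : ℝ ↦ η (s • α + y) * s ^ 2 :=
  (hη.comp ((continuous_id.smul continuous_const).add continuous_const)).mul (continuous_pow 2)

/-- The line integrand has compact support (`|s| ≤ R + |y|`) when `η` does and `|α| = 1`. [folklore] -/
theorem hasCompactSupport_eta_line (hR : ∀ z : E3, R < ‖z‖ → η z = 0) {α : E3} (hα : ‖α‖ = 1) (y : E3) :
    HasCompactSupport fun s : ℝ ↦ η (s • α + y) * s ^ 2 := by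
  refine HasCompactSupport.intro (isCompact_closedBall (0 : ℝ) (R + ‖y‖)) fun s hs ↦ ?_
  rw [mem_closedBall, dist_zero_right, Real.norm_eq_abs, not_le] at hs
  rw [eta_line_eq_zero hR hα hs, zero_mul]

/-- The line integrand is integrable. [folklore] -/
theorem integrable_eta_line (hη : Continuous η) (hR : ∀ z : E3, R < ‖z‖ → η z = 0) {α : E3} (hα : ‖α‖ = 1)
    (y : E3) : Integrable fun s : ℝ ↦ η (s • α + y) * s ^ 2 :=
  (continuous_eta_line hη α y).integrable_of_hasCompactSupport (hasCompactSupport_eta_line hR hα y)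

/-- **`∂_r w_y(r, α) = −η(rα + y) r²`** (fundamental theorem of calculus for the tail integral).
[cite: MaoOhTao2023, Lemma 2.3] -/
theorem hasDerivAt_bogovskiiWeight (hη : Continuous η) (hR : ∀ z : E3, R < ‖z‖ → η z = 0) {α : E3}
    (hα : ‖α‖ = 1) (y : E3) (r : ℝ) :
    HasDerivAt (fun ρ ↦ bogovskiiWeight η y ρ α) (-(η (r • α + y) * r ^ 2)) r := by
  set q : ℝ → ℝ := fun s ↦ η (s • α + y) * s ^ 2 with hq
  have hqc : Continuous q := continuous_eta_line hη α y
  have hqi : Integrable q := integrable_eta_line hη hR hα y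
  have hrepr : ∀ ρ, bogovskiiWeight η y ρ α =
      (∫ u, q u) - ((∫ u in Iic 0, q u) + ∫ u in (0 : ℝ)..ρ, q u) := by
    intro ρ
    have h1 := intervalIntegral.integral_Iic_add_Ioi (hqi.integrableOn (s := Iic ρ))
      (hqi.integrableOn (s := Ioi ρ))
    have h2 := intervalIntegral.integral_Iic_sub_Iic (hqi.integrableOn (s := Iic 0))
      (hqi.integrableOn (s := Iic ρ))
    simp only [bogovskiiWeight]
    linarith
  rw [funext hrepr]
  have hprim : HasDerivAt (fun ρ ↦ ∫ u in (0 : ℝ)..ρ, q u) (q r) r :=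
    intervalIntegral.integral_hasDerivAt_right (hqc.intervalIntegrable _ _)
      (hqc.stronglyMeasurableAtFilter _ _) hqc.continuousAt
  have h := (hprim.const_add (∫ u in Iic 0, q u)).const_sub (∫ u, q u)
  simpa [hq] using h

/-- The weight vanishes beyond the support: `w_y(r, α) = 0` for `r ≥ R + |y|`. [folklore] -/
theorem bogovskiiWeight_eq_zero_of_le (hR : ∀ z : E3, R < ‖z‖ → η z = 0) {α : E3} (hα : ‖α‖ = 1)
    {r : ℝ} (hr : R + ‖y‖ ≤ r) : bogovskiiWeight η y r α = 0 := by
  refine setIntegral_eq_zero_of_forall_eq_zero fun s hs ↦ ?_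
  have hs' : R + ‖y‖ < |s| := lt_of_le_of_lt hr ((mem_Ioi.1 hs).trans_le (le_abs_self s))
  rw [eta_line_eq_zero hR hα hs', zero_mul]

/-- Shifted form on a fixed domain: `w_y(r, α) = ∫_{(0,∞)} η((u + r)α + y) (u + r)² du`. [folklore] -/
theorem bogovskiiWeight_eq_integral_Ioi_zero (η : E3 → ℝ) (y : E3) (r : ℝ) (α : E3) :
    bogovskiiWeight η y r α = ∫ u in Ioi (0 : ℝ), η ((u + r) • α + y) * (u + r) ^ 2 := by
  simp only [bogovskiiWeight]
  rw [← integral_indicator measurableSet_Ioi, ← integral_indicator measurableSet_Ioi,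
    ← integral_add_right_eq_self _ r]
  congr 1
  funext u
  simp only [indicator]
  have : (u + r ∈ Ioi r) ↔ (u ∈ Ioi (0 : ℝ)) := by simp
  by_cases hu : u ∈ Ioi (0 : ℝ)
  · rw [if_pos (this.2 hu), if_pos hu]
  · rw [if_neg (fun h ↦ hu (this.1 h)), if_neg hu]

/-- A uniform bound `|w_y(r, α)| ≤ W` (independent of `r` and of the unit vector `α`): the line integrand is bounded
by `sup|η| · T²` and supported in `|s| ≤ T`, `T = |R + |y|| + 1`. [folklore] -/
theorem exists_abs_bogovskiiWeight_le (hη : Continuous η) (hR : ∀ z : E3, R < ‖z‖ → η z = 0) (y : E3) :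
    ∃ W, ∀ (r : ℝ) (α : E3), ‖α‖ = 1 → |bogovskiiWeight η y r α| ≤ W := by
  obtain ⟨M, hM⟩ := hη.bounded_above_of_compact_support
    (HasCompactSupport.intro (isCompact_closedBall (0 : E3) R) fun z hz ↦ hR z (by
      rwa [mem_closedBall, dist_zero_right, not_le] at hz))
  have hM0 : 0 ≤ M := (norm_nonneg _).trans (hM 0)
  set T : ℝ := |R + ‖y‖| + 1 with hT
  have hT0 : 0 < T := by positivity
  refine ⟨2 * T * (M * T ^ 2), fun r α hα ↦ ?_⟩
  set q : ℝ → ℝ := fun s ↦ η (s • α + y) * s ^ 2 with hq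
  have hqi : Integrable q := integrable_eta_line hη hR hα y
  have hbound : ∀ s, ‖q s‖ ≤ (Icc (-T) T).indicator (fun _ ↦ M * T ^ 2) s := by
    intro s
    by_cases hs : s ∈ Icc (-T) T
    · rw [indicator_of_mem hs, hq, Real.norm_eq_abs, abs_mul, abs_pow]
      have h1 : |η (s • α + y)| ≤ M := by rw [← Real.norm_eq_abs]; exact hM _
      have h2 : |s| ≤ T := abs_le.2 ⟨hs.1, hs.2⟩
      exact mul_le_mul h1 (pow_le_pow_left₀ (abs_nonneg s) h2 2) (by positivity) hM0
    · rw [indicator_of_notMem hs]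
      have hTs : T < |s| := by
        by_contra h
        exact hs (abs_le.1 (not_lt.1 h))
      have hs' : R + ‖y‖ < |s| := by linarith [le_abs_self (R + ‖y‖)]
      show ‖η (s • α + y) * s ^ 2‖ ≤ 0
      rw [Real.norm_eq_abs, eta_line_eq_zero hR hα hs', zero_mul, abs_zero]
  have hind : Integrable fun s : ℝ ↦ (Icc (-T) T).indicator (fun _ ↦ M * T ^ 2) s :=
    (integrable_indicator_iff measurableSet_Icc).2 (continuous_const.integrableOn_Icc)
  calc |bogovskiiWeight η y r α| = ‖∫ s in Ioi r, q s‖ := by rw [Real.norm_eq_abs]; rfl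
    _ ≤ ∫ s in Ioi r, ‖q s‖ := norm_integral_le_integral_norm _
    _ ≤ ∫ s, ‖q s‖ := setIntegral_le_integral hqi.norm (Eventually.of_forall fun s ↦ norm_nonneg _)
    _ ≤ ∫ s, (Icc (-T) T).indicator (fun _ ↦ M * T ^ 2) s := integral_mono hqi.norm hind hbound
    _ = 2 * T * (M * T ^ 2) := by
        rw [integral_indicator measurableSet_Icc, setIntegral_const, Real.volume_real_Icc_of_le (by linarith),
          smul_eq_mul]
        ring


/-- **Joint continuity of the weight** on `ℝ × 𝕊²`: `(r, α) ↦ w_y(r, α)` is continuous on `univ ×ˢ 𝕊²` (parametric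
integral over the fixed domain `(0, ∞)` of a continuous integrand with locally uniform compact support,
`bogovskiiWeight_eq_integral_Ioi_zero`). [folklore] -/
theorem continuousOn_bogovskiiWeight (hη : Continuous η) (hR : ∀ z : E3, R < ‖z‖ → η z = 0) (y : E3) :
    ContinuousOn (fun p : ℝ × E3 ↦ bogovskiiWeight η y p.1 p.2) (univ ×ˢ sphere (0 : E3) 1) := by
  -- continuity on `[-T, T] × 𝕊²` for every `T`
  have hT : ∀ T : ℝ, ContinuousOn (fun p : ℝ × E3 ↦ bogovskiiWeight η y p.1 p.2)
      (Icc (-T) T ×ˢ sphere (0 : E3) 1) := by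
    intro T
    have hf : ContinuousOn (uncurry fun (p : ℝ × E3) (u : ℝ) ↦ η ((u + p.1) • p.2 + y) * (u + p.1) ^ 2)
        ((Icc (-T) T ×ˢ sphere (0 : E3) 1) ×ˢ univ) := by
      refine Continuous.continuousOn ?_
      refine (hη.comp ?_).mul ((continuous_snd.add (continuous_fst.comp continuous_fst)).pow 2)
      exact ((continuous_snd.add (continuous_fst.comp continuous_fst)).smul
        (continuous_snd.comp continuous_fst)).add continuous_const
    have hk : IsCompact (Icc (-(R + ‖y‖ + T)) (R + ‖y‖ + T)) := isCompact_Icc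
    have h := continuousOn_integral_of_compact_support (μ := (volume : Measure ℝ).restrict (Ioi 0)) hk hf
      (fun p u hp hu ↦ ?_)
    · refine h.congr fun p _ ↦ ?_
      exact bogovskiiWeight_eq_integral_Ioi_zero η y p.1 p.2
    · have hα : ‖p.2‖ = 1 := by simpa using hp.2
      have hr : |p.1| ≤ T := abs_le.2 ⟨hp.1.1, hp.1.2⟩
      have hu' : R + ‖y‖ + T < |u| := by
        by_contra hcon
        exact hu (abs_le.1 (not_lt.1 hcon))
      have hs : R + ‖y‖ < |u + p.1| := by
        have := abs_add_le u p.1  -- |u + r| ≥ |u| - |r|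
        have h2 : |u| ≤ |u + p.1| + |p.1| := by
          calc |u| = |(u + p.1) - p.1| := by rw [add_sub_cancel_right]
            _ ≤ |u + p.1| + |p.1| := abs_sub _ _
        linarith
      show η ((u + p.1) • p.2 + y) * (u + p.1) ^ 2 = 0
      rw [eta_line_eq_zero hR hα hs, zero_mul]
  -- glue
  intro p hp
  set T : ℝ := |p.1| + 1 with hTdef
  have hmem : p ∈ Icc (-T) T ×ˢ sphere (0 : E3) 1 :=
    ⟨⟨by linarith [neg_abs_le p.1], by linarith [le_abs_self p.1]⟩, hp.2⟩
  refine ((hT T).continuousWithinAt hmem).mono_of_mem_nhdsWithin ?_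
  refine mem_nhdsWithin.2 ⟨Ioo (-T) T ×ˢ univ, isOpen_Ioo.prod isOpen_univ,
    ⟨⟨by linarith [neg_abs_le p.1], by linarith [le_abs_self p.1]⟩, mem_univ _⟩, ?_⟩
  rintro q ⟨⟨hq1, -⟩, ⟨-, hq2⟩⟩
  exact ⟨⟨hq1.1.le, hq1.2.le⟩, hq2⟩

/-- The weight restricted to `ℝ × 𝕊²` (sphere as a subtype) is jointly continuous. [folklore] -/
theorem continuous_bogovskiiWeight_sphere (hη : Continuous η) (hR : ∀ z : E3, R < ‖z‖ → η z = 0)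
    (y : E3) :
    Continuous (uncurry fun (r : ℝ) (α : sphere (0 : E3) 1) ↦ bogovskiiWeight η y r (α : E3)) := by
  have h := (continuousOn_bogovskiiWeight hη hR y).comp_continuous
    (continuous_fst.prodMk (continuous_subtype_val.comp continuous_snd))
    (fun q ↦ ⟨mem_univ _, q.2.2⟩)
  exact h

/-- The weight as a function on `ℝ³ ∖ {0}`, `z ↦ w_y(|z|, z/|z|)`, is continuous off the origin. [folklore] -/
theorem continuousOn_bogovskiiWeight_norm (hη : Continuous η) (hR : ∀ z : E3, R < ‖z‖ → η z = 0)
    (y : E3) :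
    ContinuousOn (fun z : E3 ↦ bogovskiiWeight η y ‖z‖ (‖z‖⁻¹ • z)) {0}ᶜ := by
  refine (continuousOn_bogovskiiWeight hη hR y).comp
    (continuous_norm.continuousOn.prodMk ((continuousOn_inv₀.comp continuous_norm.continuousOn
      fun x hx ↦ by simpa using hx).smul continuousOn_id)) fun z hz ↦ ⟨mem_univ _, ?_⟩
  have hz' : z ≠ 0 := hz
  show ‖z‖⁻¹ • z ∈ sphere (0 : E3) 1
  rw [mem_sphere_zero_iff_norm, norm_smul, norm_inv, norm_norm,
    inv_mul_cancel₀ (norm_ne_zero_iff.2 hz')]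

/-- **`∫_{S²} w_y(0, α) dσ(α) = ∫ η`**: at radius `0` the weight integrates to the total mass of `η` (polar
coordinates for `z ↦ η(z + y)`, via `G(r) = ∫ w_y(r, α) dσ`, `G' = −r² ∫ η(rα + y) dσ`, `G = 0` for large `r`).
[cite: MaoOhTao2023, Lemma 2.3] -/
theorem integral_bogovskiiWeight_zero (hη : Continuous η) (hR : ∀ z : E3, R < ‖z‖ → η z = 0) (y : E3) :
    ∫ α, bogovskiiWeight η y 0 (α : E3) ∂(volume : Measure E3).toSphere = ∫ z : E3, η z := by
  set w : ℝ → sphere (0 : E3) 1 → ℝ := fun r α ↦ bogovskiiWeight η y r (α : E3) with hw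
  set w' : ℝ → sphere (0 : E3) 1 → ℝ := fun r α ↦ -(η (r • (α : E3) + y) * r ^ 2) with hw'
  have hwc : Continuous (uncurry w) := continuous_bogovskiiWeight_sphere hη hR y
  have hw'c : Continuous (uncurry w') :=
    ((hη.comp ((continuous_fst.smul (continuous_subtype_val.comp continuous_snd)).add
      continuous_const)).mul (continuous_fst.pow 2)).neg
  have hwd : ∀ r α, HasDerivAt (fun ρ ↦ w ρ α) (w' r α) r := fun r α ↦
    hasDerivAt_bogovskiiWeight hη hR (norm_eq_of_mem_sphere α) y r
  -- `G(r) = ∫ w(r, α) dσ` has derivative `∫ w'(r, α) dσ`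
  have hG : ∀ r, HasDerivAt (fun ρ : ℝ ↦ ∫ α, w ρ α ∂(volume : Measure E3).toSphere)
      (∫ α, w' r α ∂(volume : Measure E3).toSphere) r := by
    intro r
    have h := hasDerivAt_integral_rweight_mul hwc hw'c hwd (contDiff_const (c := (1 : ℝ))) r
    simpa using h
  have hG0 : ∀ ρ, R + ‖y‖ ≤ ρ → (∫ α, w ρ α ∂(volume : Measure E3).toSphere) = 0 := fun ρ hρ ↦ by
    have h : ∀ α : sphere (0 : E3) 1, w ρ α = 0 := fun α ↦
      bogovskiiWeight_eq_zero_of_le hR (norm_eq_of_mem_sphere α) hρ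
    simp [h]
  have hG'0 : ∀ ρ, R + ‖y‖ < ρ → (∫ α, w' ρ α ∂(volume : Measure E3).toSphere) = 0 := fun ρ hρ ↦ by
    have h : ∀ α : sphere (0 : E3) 1, w' ρ α = 0 := fun α ↦ by
      simp only [hw']
      rw [eta_line_eq_zero hR (norm_eq_of_mem_sphere α) (hρ.trans_le (le_abs_self ρ)), zero_mul,
        neg_zero]
    simp [h]
  have hG'c : Continuous fun ρ : ℝ ↦ ∫ α, w' ρ α ∂(volume : Measure E3).toSphere := by
    have h := continuous_integral_rweight hw'c (g := fun _ ↦ (1 : ℝ)) continuous_const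
    simpa using h
  have hint : IntegrableOn (fun ρ : ℝ ↦ ∫ α, w' ρ α ∂(volume : Measure E3).toSphere) (Ioi 0) :=
    integrableOn_Ioi_of_eq_zero_of_lt hG'c hG'0
  have htends : Tendsto (fun ρ : ℝ ↦ ∫ α, w ρ α ∂(volume : Measure E3).toSphere) atTop (𝓝 0) := by
    refine tendsto_const_nhds.congr' ?_
    filter_upwards [eventually_ge_atTop (R + ‖y‖)] with ρ hρ
    exact (hG0 ρ hρ).symm
  have key := integral_Ioi_of_hasDerivAt_of_tendsto (hG 0).continuousAt.continuousWithinAt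
    (fun ρ _ ↦ hG ρ) hint htends
  -- `∫_{Ioi 0} G' = -∫ η(z + y) dz` by polar coordinates
  have hpolar : ∫ z : E3, η (z + y) = -∫ ρ in Ioi (0 : ℝ), ∫ α, w' ρ α ∂(volume : Measure E3).toSphere := by
    have hηc : HasCompactSupport fun z : E3 ↦ η (z + y) := by
      refine HasCompactSupport.intro (isCompact_closedBall (-y) R) fun z hz ↦ hR _ ?_
      rwa [mem_closedBall, not_le, dist_eq_norm, sub_neg_eq_add] at hz
    have hi : Integrable fun z : E3 ↦ η (z + y) :=
      (hη.comp (continuous_id.add continuous_const)).integrable_of_hasCompactSupport hηc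
    rw [integral_eq_integral_Ioi_sphereIntegral (volume : Measure E3) hi, ← integral_neg]
    refine setIntegral_congr_fun measurableSet_Ioi fun ρ _ ↦ ?_
    have hdim : Module.finrank ℝ E3 - 1 = 2 := by rw [finrank_euclideanSpace_fin]
    rw [hdim, smul_eq_mul, sphereIntegral_def, ← integral_neg, ← integral_const_mul]
    refine integral_congr_ae (ae_of_all _ fun α ↦ ?_)
    simp only [hw', neg_neg]
    ring
  calc ∫ α, w 0 α ∂(volume : Measure E3).toSphere
      = -∫ ρ in Ioi (0 : ℝ), ∫ α, w' ρ α ∂(volume : Measure E3).toSphere := by linarith [key]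
    _ = ∫ z : E3, η (z + y) := hpolar.symm
    _ = ∫ z : E3, η z := integral_add_right_eq_self (fun z : E3 ↦ η z) y

end Weight

/-! ### The Bogovskiĭ identity `div (w_y z/|z|³) = δ₀ − η(· + y)` -/

section FirstOrder

variable {η φ : E3 → ℝ} {y : E3} {R : ℝ}

/-- **Radial form of the Bogovskiĭ identity.** For `η ∈ C_c(ℝ³)`, `φ ∈ C¹_c(ℝ³)` and `y ∈ ℝ³`,
`∫_0^∞ ∫_{S²} w_y(r, α) Dφ(rα)·α dσ dr = −φ(0) ∫ η + ∫ η(z + y) φ(z) dz`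
(fundamental theorem of calculus for `G(r) = ∫ w_y(r,α) φ(rα) dσ`, whose derivative has the extra term
`∫ ∂_r w_y · φ(rα) dσ = −r² ∫ η(rα + y) φ(rα) dσ`, integrated back to `−∫ η(z + y) φ(z) dz` in polar coordinates).
[cite: MaoOhTao2023, Lemma 2.3 (proof)] -/
theorem integral_Ioi_integral_bogovskiiWeight_mul_fderiv (hη : Continuous η)
    (hR : ∀ z : E3, R < ‖z‖ → η z = 0) (hφ : ContDiff ℝ 1 φ) (hφc : HasCompactSupport φ) (y : E3) :
    ∫ r in Ioi (0 : ℝ), ∫ α, bogovskiiWeight η y r (α : E3) * fderiv ℝ φ (r • (α : E3)) (α : E3)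
        ∂(volume : Measure E3).toSphere =
      -(φ 0 * ∫ z : E3, η z) + ∫ z : E3, η (z + y) * φ z := by
  obtain ⟨Rφ, hRφ⟩ := hφc.isCompact.isBounded.subset_closedBall 0
  set w : ℝ → sphere (0 : E3) 1 → ℝ := fun r α ↦ bogovskiiWeight η y r (α : E3) with hw
  set w' : ℝ → sphere (0 : E3) 1 → ℝ := fun r α ↦ -(η (r • (α : E3) + y) * r ^ 2) with hw'
  have hwc : Continuous (uncurry w) := continuous_bogovskiiWeight_sphere hη hR y
  have hw'c : Continuous (uncurry w') :=
    ((hη.comp ((continuous_fst.smul (continuous_subtype_val.comp continuous_snd)).add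
      continuous_const)).mul (continuous_fst.pow 2)).neg
  have hwd : ∀ r α, HasDerivAt (fun ρ ↦ w ρ α) (w' r α) r := fun r α ↦
    hasDerivAt_bogovskiiWeight hη hR (norm_eq_of_mem_sphere α) y r
  have hG := fun r ↦ hasDerivAt_integral_rweight_mul hwc hw'c hwd hφ r
  -- vanishing for large radius
  set T : ℝ := max (R + ‖y‖) Rφ with hT
  have hw0 : ∀ ρ, T < ρ → ∀ α : sphere (0 : E3) 1, w ρ α = 0 := fun ρ hρ α ↦
    bogovskiiWeight_eq_zero_of_le hR (norm_eq_of_mem_sphere α) ((le_max_left _ _).trans hρ.le)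
  have hw'0 : ∀ ρ, T < ρ → ∀ α : sphere (0 : E3) 1, w' ρ α = 0 := fun ρ hρ α ↦ by
    simp only [hw']
    rw [eta_line_eq_zero hR (norm_eq_of_mem_sphere α)
      (((le_max_left _ _).trans_lt hρ).trans_le (le_abs_self ρ)), zero_mul, neg_zero]
  have hφ0 : ∀ ρ, T < ρ → ∀ α : sphere (0 : E3) 1, φ (ρ • (α : E3)) = 0 := fun ρ hρ α ↦ by
    refine eq_zero_of_lt_norm hRφ ?_
    rw [norm_smul_unitSphere]
    exact ((le_max_right _ _).trans_lt hρ).trans_le (le_abs_self ρ)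
  have hG0 : ∀ ρ, T < ρ → (∫ α, w ρ α * φ (ρ • (α : E3)) ∂(volume : Measure E3).toSphere) = 0 :=
    fun ρ hρ ↦ by simp [hw0 ρ hρ]
  have hG'0 : ∀ ρ, T < ρ → (∫ α, (w' ρ α * φ (ρ • (α : E3)) + w ρ α * fderiv ℝ φ (ρ • (α : E3)) (α : E3))
      ∂(volume : Measure E3).toSphere) = 0 := fun ρ hρ ↦ by simp [hw0 ρ hρ, hw'0 ρ hρ]
  have hA0 : ∀ ρ, T < ρ → (∫ α, w' ρ α * φ (ρ • (α : E3)) ∂(volume : Measure E3).toSphere) = 0 :=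
    fun ρ hρ ↦ by simp [hw'0 ρ hρ]
  -- continuity and integrability in the radius
  have hG'c := continuous_integral_rweight_deriv hwc hw'c hφ
  have hAc : Continuous fun ρ : ℝ ↦ ∫ α, w' ρ α * φ (ρ • (α : E3)) ∂(volume : Measure E3).toSphere :=
    continuous_integral_rweight hw'c hφ.continuous
  have hG'int := integrableOn_Ioi_of_eq_zero_of_lt hG'c hG'0
  have hAint := integrableOn_Ioi_of_eq_zero_of_lt hAc hA0
  -- the fundamental theorem of calculus for `G`
  have htends : Tendsto (fun ρ : ℝ ↦ ∫ α, w ρ α * φ (ρ • (α : E3)) ∂(volume : Measure E3).toSphere)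
      atTop (𝓝 0) := by
    refine tendsto_const_nhds.congr' ?_
    filter_upwards [eventually_gt_atTop T] with ρ hρ
    exact (hG0 ρ hρ).symm
  have key := integral_Ioi_of_hasDerivAt_of_tendsto (hG 0).continuousAt.continuousWithinAt
    (fun ρ _ ↦ hG ρ) hG'int htends
  have hGzero : (∫ α, w 0 α * φ ((0 : ℝ) • (α : E3)) ∂(volume : Measure E3).toSphere) =
      φ 0 * ∫ z : E3, η z := by
    simp only [zero_smul]
    rw [integral_mul_const, integral_bogovskiiWeight_zero hη hR y, mul_comm]
  -- split `G' = A + B` under the radial integral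
  have hsplit : ∀ ρ, (∫ α, (w' ρ α * φ (ρ • (α : E3)) + w ρ α * fderiv ℝ φ (ρ • (α : E3)) (α : E3))
      ∂(volume : Measure E3).toSphere) =
      (∫ α, w' ρ α * φ (ρ • (α : E3)) ∂(volume : Measure E3).toSphere) +
        ∫ α, w ρ α * fderiv ℝ φ (ρ • (α : E3)) (α : E3) ∂(volume : Measure E3).toSphere := by
    intro ρ
    have hc1 : Continuous fun α : sphere (0 : E3) 1 ↦ w' ρ α * φ (ρ • (α : E3)) :=
      hw'c.comp (Continuous.prodMk_right ρ) |>.mul (hφ.continuous.comp (continuous_subtype_val.const_smul ρ))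
    have hc2 : Continuous fun α : sphere (0 : E3) 1 ↦ w ρ α * fderiv ℝ φ (ρ • (α : E3)) (α : E3) :=
      (hwc.comp (Continuous.prodMk_right ρ)).mul
        ((((hφ.continuous_fderiv one_ne_zero).comp (continuous_subtype_val.const_smul ρ))).clm_apply
          continuous_subtype_val)
    exact integral_add (integrableOn_univ.1 (hc1.continuousOn.integrableOn_compact isCompact_univ))
      (integrableOn_univ.1 (hc2.continuousOn.integrableOn_compact isCompact_univ))
  have hBint : IntegrableOn (fun ρ : ℝ ↦ ∫ α, w ρ α * fderiv ℝ φ (ρ • (α : E3)) (α : E3)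
      ∂(volume : Measure E3).toSphere) (Ioi 0) := by
    refine (hG'int.sub hAint).congr_fun (fun ρ _ ↦ ?_) measurableSet_Ioi
    simp only [Pi.sub_apply]
    rw [hsplit ρ]
    ring
  have hsum : ∫ ρ in Ioi (0 : ℝ), (∫ α, (w' ρ α * φ (ρ • (α : E3)) + w ρ α * fderiv ℝ φ (ρ • (α : E3)) (α : E3))
      ∂(volume : Measure E3).toSphere) =
      (∫ ρ in Ioi (0 : ℝ), ∫ α, w' ρ α * φ (ρ • (α : E3)) ∂(volume : Measure E3).toSphere) +
        ∫ ρ in Ioi (0 : ℝ), ∫ α, w ρ α * fderiv ℝ φ (ρ • (α : E3)) (α : E3)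
          ∂(volume : Measure E3).toSphere := by
    rw [← integral_add hAint hBint]
    exact setIntegral_congr_fun measurableSet_Ioi fun ρ _ ↦ hsplit ρ
  -- the extra term in polar coordinates
  have hpolar : ∫ z : E3, η (z + y) * φ z =
      -∫ ρ in Ioi (0 : ℝ), ∫ α, w' ρ α * φ (ρ • (α : E3)) ∂(volume : Measure E3).toSphere := by
    have hi : Integrable fun z : E3 ↦ η (z + y) * φ z :=
      ((hη.comp (continuous_id.add continuous_const)).mul hφ.continuous).integrable_of_hasCompactSupport
        hφc.mul_left
    rw [integral_eq_integral_Ioi_sphereIntegral (volume : Measure E3) hi, ← integral_neg]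
    refine setIntegral_congr_fun measurableSet_Ioi fun ρ _ ↦ ?_
    have hdim : Module.finrank ℝ E3 - 1 = 2 := by rw [finrank_euclideanSpace_fin]
    rw [hdim, smul_eq_mul, sphereIntegral_def, ← integral_neg, ← integral_const_mul]
    refine integral_congr_ae (ae_of_all _ fun α ↦ ?_)
    simp only [hw']
    ring
  -- conclude
  rw [hsum, hGzero] at key
  linarith [key, hpolar]

/-- A bound for the weight on `ℝ³ ∖ {0}`. [folklore] -/
theorem exists_abs_bogovskiiWeight_norm_le (hη : Continuous η) (hR : ∀ z : E3, R < ‖z‖ → η z = 0)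
    (y : E3) : ∃ W, ∀ z : E3, z ≠ 0 → |bogovskiiWeight η y ‖z‖ (‖z‖⁻¹ • z)| ≤ W := by
  obtain ⟨W, hW⟩ := exists_abs_bogovskiiWeight_le hη hR y
  refine ⟨W, fun z hz ↦ hW _ _ ?_⟩
  rw [norm_smul, norm_inv, norm_norm, inv_mul_cancel₀ (norm_ne_zero_iff.2 hz)]

/-- **The Bogovskiĭ identity, weak form** (Mao–Oh–Tao, proof of Lemma 2.3; Bogovskiĭ 1979): for `η ∈ C_c(ℝ³)`
vanishing off `B̄_R`, `y ∈ ℝ³` and `φ ∈ C¹_c(ℝ³)`,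
`∫ w_y(|z|, z/|z|) |z|⁻³ Dφ(z)·z dz = −φ(0) ∫ η + ∫ η(z + y) φ(z) dz`,
i.e. `∂_{zⁱ} [ (zⁱ/|z|³) ∫_{|z|}^∞ η(r z/|z| + y) r² dr ] = (∫ η) δ₀ − η(z + y)` in `𝒟'(ℝ³)` (`= δ₀ − η(z + y)` for
`∫ η = 1`, `…_eq_sub`). [cite: MaoOhTao2023, Lemma 2.3 (proof)] -/
theorem integral_bogovskiiWeight_fderiv_apply_self_eq (hη : Continuous η)
    (hR : ∀ z : E3, R < ‖z‖ → η z = 0) (hφ : ContDiff ℝ 1 φ) (hφc : HasCompactSupport φ) (y : E3) :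
    ∫ z : E3, bogovskiiWeight η y ‖z‖ (‖z‖⁻¹ • z) * ((‖z‖ ^ 3)⁻¹ * fderiv ℝ φ z z) =
      -(φ 0 * ∫ z : E3, η z) + ∫ z : E3, η (z + y) * φ z := by
  -- integrability
  obtain ⟨W, hW⟩ := exists_abs_bogovskiiWeight_norm_le hη hR y
  obtain ⟨M, hM⟩ := (hφ.continuous_fderiv one_ne_zero).bounded_above_of_compact_support
    (hφc.fderiv (𝕜 := ℝ))
  have hint : Integrable fun z : E3 ↦
      bogovskiiWeight η y ‖z‖ (‖z‖⁻¹ • z) * ((‖z‖ ^ 3)⁻¹ * fderiv ℝ φ z z) := by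
    refine integrable_weight_mul_of_le (continuousOn_bogovskiiWeight_norm hη hR y) hW
      ((hφ.continuous_fderiv one_ne_zero).clm_apply continuous_id) ?_ (C := M) fun z ↦ ?_
    · exact (hφc.fderiv (𝕜 := ℝ)).mono (support_subset_iff'.2 fun z hz ↦ by
        rw [notMem_support.1 hz]; rfl)
    · rw [← Real.norm_eq_abs]
      exact (ContinuousLinearMap.le_opNorm _ _).trans (mul_le_mul_of_nonneg_right (hM z) (norm_nonneg _))
  rw [integral_eq_integral_Ioi_sphereIntegral (volume : Measure E3) hint,
    ← integral_Ioi_integral_bogovskiiWeight_mul_fderiv hη hR hφ hφc y]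
  refine setIntegral_congr_fun measurableSet_Ioi fun r hr ↦ ?_
  have hr0 : (0 : ℝ) < r := hr
  have hdim : Module.finrank ℝ E3 - 1 = 2 := by rw [finrank_euclideanSpace_fin]
  rw [hdim, smul_eq_mul, sphereIntegral_def, ← integral_const_mul]
  refine integral_congr_ae (ae_of_all _ fun α ↦ ?_)
  simp only
  rw [norm_smul_sphere hr0.le α, smul_smul, inv_mul_cancel₀ hr0.ne', one_smul, map_smul, smul_eq_mul]
  field_simp

/-- The Bogovskiĭ identity for a normalised bump (`∫ η = 1`): `∫ w_y |z|⁻³ Dφ·z = −φ(0) + ∫ η(z + y) φ(z) dz`.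
[cite: MaoOhTao2023, Lemma 2.3 (proof)] -/
theorem integral_bogovskiiWeight_fderiv_apply_self_eq_sub (hη : Continuous η)
    (hR : ∀ z : E3, R < ‖z‖ → η z = 0) (hη1 : ∫ z : E3, η z = 1) (hφ : ContDiff ℝ 1 φ)
    (hφc : HasCompactSupport φ) (y : E3) :
    ∫ z : E3, bogovskiiWeight η y ‖z‖ (‖z‖⁻¹ • z) * ((‖z‖ ^ 3)⁻¹ * fderiv ℝ φ z z) =
      -φ 0 + ∫ z : E3, η (z + y) * φ z := by
  rw [integral_bogovskiiWeight_fderiv_apply_self_eq hη hR hφ hφc y, hη1, mul_one]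

end FirstOrder

/-! ### (S1): support in a star-shaped set -/

section Support

variable {η : E3 → ℝ} {y : E3}

/-- **(S1) for the Bogovskiĭ-type kernel.** Let `Ω` be star-shaped with respect to every point of `B` (for `b ∈ B`
and `x ∈ Ω` the segment `[b, x]` lies in `Ω`), `supp η ⊆ B` and `y ∈ Ω`. If the weight `w_y(|z|, z/|z|)` of
`Ψ_η(z + y, y)` does not vanish at `z ≠ 0`, then `z + y ∈ Ω`: indeed `η(s z/|z| + y) ≠ 0` for some `s > |z|`, so
`b = y + s z/|z| ∈ B` and `z + y ∈ [y, b] ⊆ Ω`. Hence `supp S f ⊆ Ω` when `supp f ⊆ Ω`.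
[cite: MaoOhTao2023, Lemma 2.3 (S1)] -/
theorem add_mem_of_bogovskiiWeight_ne_zero {Ω B : Set E3} (hΩ : ∀ b ∈ B, StarConvex ℝ b Ω)
    (hηB : ∀ z, η z ≠ 0 → z ∈ B) (hy : y ∈ Ω) {z : E3} (hz : z ≠ 0)
    (hw : bogovskiiWeight η y ‖z‖ (‖z‖⁻¹ • z) ≠ 0) : z + y ∈ Ω := by
  have hn : 0 < ‖z‖ := norm_pos_iff.2 hz
  have hex : ∃ s, ‖z‖ < s ∧ η (s • (‖z‖⁻¹ • z) + y) ≠ 0 := by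
    by_contra hcon
    push Not at hcon
    apply hw
    show ∫ s in Ioi ‖z‖, η (s • (‖z‖⁻¹ • z) + y) * s ^ 2 = 0
    refine setIntegral_eq_zero_of_forall_eq_zero fun s hs ↦ ?_
    rw [hcon s hs, zero_mul]
  obtain ⟨s, hs, hηs⟩ := hex
  have hs0 : 0 < s := hn.trans hs
  have ha1 : ‖z‖ / s ≤ 1 := (div_le_one hs0).2 hs.le
  have key := hΩ _ (hηB _ hηs) hy (div_nonneg (norm_nonneg z) hs0.le) (sub_nonneg.2 ha1)
    (by ring : ‖z‖ / s + (1 - ‖z‖ / s) = 1)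
  have hpt : (‖z‖ / s) • (s • (‖z‖⁻¹ • z) + y) + (1 - ‖z‖ / s) • y = z + y := by
    rw [smul_add, smul_smul, smul_smul, show ‖z‖ / s * s * ‖z‖⁻¹ = 1 by field_simp, one_smul, add_assoc,
      ← add_smul, show ‖z‖ / s + (1 - ‖z‖ / s) = 1 by ring, one_smul]
  rw [← hpt]
  exact key

/-- (S1) at the level of the kernel entries `Ψ^{ij}_η(z + y, y) = w_y(|z|, z/|z|) zⁱzʲ/|z|³`: a non-vanishing entry at
`z` forces `z + y ∈ Ω`. [cite: MaoOhTao2023, Lemma 2.3 (S1)] -/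
theorem add_mem_of_bogovskiiKernel_ne_zero {Ω B : Set E3} (hΩ : ∀ b ∈ B, StarConvex ℝ b Ω)
    (hηB : ∀ z, η z ≠ 0 → z ∈ B) (hy : y ∈ Ω) {z : E3} (i j : Fin 3)
    (hΨ : bogovskiiWeight η y ‖z‖ (‖z‖⁻¹ • z) * (z i * (z j * (‖z‖ ^ 3)⁻¹)) ≠ 0) : z + y ∈ Ω := by
  have hz : z ≠ 0 := by
    rintro rfl
    simp at hΨ
  exact add_mem_of_bogovskiiWeight_ne_zero hΩ hηB hy hz (left_ne_zero_of_mul hΨ)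

end Support

end MaoOhTao

end Literature.Geometry.Lorentzian

end
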